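import Literature.AlgebraicGeometry.Motives.AbelianVarietyWeilPairingRadicalComposite
import Literature.AlgebraicGeometry.Motives.AbelianVarietyWeilPairingAlternating
import Literature.AlgebraicGeometry.Motives.AlgPointsMapSurjectiveAlgClosed
import Literature.GroupTheory.Abelian.PerfectPairingAnnihilatorCardUnits
import HarnessLib

/-!
# The level Weil pairing `ē^Θ_N` on `A[N](Ω)` is PERFECT when `gcd(N, #K(Θ)) = 1`; hence `#K · #K^⊥ = N^{2g}`
# ([Lang1983AbelianVarieties] VII §2 Prop. 4, Thm. 5 (i); [MumfordAV1970] §20 (pp. 183–186), §23 (p. 233))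

Topic `Literature/AlgebraicGeometry/Motives`, namespace `Literature.AlgebraicGeometry.Motives.AbelianVariety`.  THEOREMS ONLY (no definition, no named fact,
no instance, no notation, no `sorry`).  Cell `hodgecm-mathlib` (D-0151), P6 «MOD» (crux hLiu418 = stmt-HodgeConjecture-24832, `--supports`, count-neutral):
line L3 (`stub_FROB`), ROOF road (ρ-𝔟), engine re-wire head **H4 ∕ `hcard` — THE PERFECTNESS DIGIT** (LA3-p03 (g2) census (4); LA6-p03 (g0) (C3)
2026-09-02T04:2x–04:38Z «the ONE non-★ digit is PERFECTNESS of `ē^Θ_n` on `A[n](κ̄)`»).  Everything is assembled from ★ rows: Lang VII §2 Prop. 4 in the tree's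
form `weilDiv_linEquiv_zero_of_forall_weilPairingLevel_eq_one` («`ē^Θ_N(·, Q) ≡ 1 ⇒ t_Q^*Θ ∼ Θ`, i.e. `Q ∈ K(Θ)`»), the Kummer hypotheses on `[N]`
(`isIsogeny_zsmul_id_holds`, `IsIsogeny.flat_toSchemeHom_holds`, `kerRank_zsmul_id_holds`, `natCard_torsionPoints_eq_of_isAlgClosed` — discharged exactly as in ★
`weilPairingLevel_radical_pow_card_KTheta_of_one_lt`), `pow_natCard_KTheta_eq_one` (`Q ∈ K(Θ) ⇒ Q^{#K(Θ)} = 1`), skew-symmetry ★ `weilPairingLevel_swap` fed by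
divisibility ★ `pow_surjective_of_isAlgClosed`, and the finite-group count ★ `PerfectPairingUnits.card_mul_card_eq_card_of_perfect_of_pow_eq_one`.
HC_CM is proved only modulo the printed citations until rung 0 closes; this file is generic and changes no count.

THE MATHEMATICS.  `A` an abelian variety over an algebraically closed field `Ω`, `N` invertible in `Ω`, `Θ` a Cartier divisor with `gcd(N, #K(Θ)) = 1`
(`K(Θ) = {x : t_x^*Θ ∼ Θ}`; finite for `Θ` ample, ★ `finite_KTheta`; for `#K(Θ)` read as `Nat.card`, an infinite `K(Θ)` has `Nat.card = 0` and the
hypothesis forces `N = 1`, where everything is trivial).  RIGHT: if `ē^Θ_N(P, Q) = 1` for all `P ∈ A[N]` then `Q ∈ K(Θ)` (Prop. 4), so `Q^{#K(Θ)} = 1` and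
`Q^N = 1`, whence `Q^{gcd(N, #K(Θ))} = Q = 1`.  LEFT: `ē(Q, P) = ē(P, Q)⁻¹` (Thm. 5 (i); `A(Ω)` is `N`-divisible), so the left radical is the right radical.
COUNT: a perfect `μ_N`-valued pairing of the finite group `A[N](Ω)` (order `N^{2 dim A}`) with itself has `#K · #K^⊥ = N^{2 dim A}` for every subgroup `K`.

* `weilPairingLevel_eq_one_of_forall_left_of_coprime` — RIGHT nondegeneracy; `weilPairingLevel_eq_one_of_forall_right_of_coprime` — LEFT nondegeneracy;
  `weilPairingLevel_perfect_of_coprime` (the pair, in the `Units.mk0` costume `hl`∕`hr` of ★ `PerfectPairingUnits`);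
* **`natCard_mul_natCard_annihilator_torsionPoints_of_coprime`** — `#K · #K' = N^{2 dim A}` for `K ≤ A[N](Ω)` and its annihilator `K'` by membership clause
  (`Q ∈ K' ↔ ∀ P ∈ K, ē^Θ_N(P, Q) = 1`); `natCard_mul_natCard_annihilator_torsionPoints_of_coprime_left` (annihilator on the left).

## References
* [Lang1983AbelianVarieties] S. Lang, *Abelian Varieties* (1983), Ch. VII §2 Prop. 4 and Thm. 5 (i).
* [MumfordAV1970] D. Mumford, *Abelian Varieties* (1970), §20 (pp. 183–186: `e_n` non-degenerate), §23 (p. 233).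
-/

universe u

open CategoryTheory CategoryTheory.Limits AlgebraicGeometry

noncomputable section

namespace Literature.AlgebraicGeometry.Motives

namespace AbelianVariety

variable {L : Type u} [Field L] [IsAlgClosed L] (A : AbelianVariety L)

/-! ### Right and left nondegeneracy -/

/-- **RIGHT NONDEGENERACY of `ē^Θ_N` when `gcd(N, #K(Θ)) = 1`** (`Ω` algebraically closed, `(N : Ω) ≠ 0`): if `ē^Θ_N(P, Q) = 1` for every `P ∈ A[N](Ω)`
then `Q = 1`.  Lang VII §2 Prop. 4 puts `Q` in `K(Θ)` (★ `weilDiv_linEquiv_zero_of_forall_weilPairingLevel_eq_one`, Kummer hypotheses as in ★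
`weilPairingLevel_radical_pow_card_KTheta_of_one_lt`), so `Q^{#K(Θ)} = 1 = Q^N` and `Q^{gcd} = Q = 1`.
[cite: Lang1983AbelianVarieties, Ch. VII §2 Prop. 4] [cite: MumfordAV1970, §20 (pp. 183–186)] -/
theorem weilPairingLevel_eq_one_of_forall_left_of_coprime {N : ℕ} (hNL : (N : L) ≠ 0)
    [IsDominant (Hom.toSchemeHom ((N : ℤ) • 𝟙 A))] (Θ : CartierDivisor A.X.left) (hcop : Nat.Coprime N (Nat.card (A.KTheta Θ)))
    (Q : A.torsionPoints L N) (h : ∀ P : A.torsionPoints L N, A.weilPairingLevel Θ P Q = 1) : Q = 1 := by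
  have hN0 : N ≠ 0 := by rintro rfl; exact hNL Nat.cast_zero
  have hNZ : ((N : ℕ) : ℤ) ≠ 0 := Int.natCast_ne_zero.mpr hN0
  have hNL' : (((N : ℕ) : ℤ) : L) ≠ 0 := by rw [Int.cast_natCast]; exact hNL
  -- the Kummer-theory hypotheses on `[N]_A`
  have hiso : IsIsogeny (((N : ℕ) : ℤ) • 𝟙 A) := isIsogeny_zsmul_id_holds A _ hNZ
  haveI : Surjective (Hom.toSchemeHom (((N : ℕ) : ℤ) • 𝟙 A)) := hiso.1
  haveI : IsFinite (Hom.toSchemeHom (((N : ℕ) : ℤ) • 𝟙 A)) := hiso.2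
  haveI : Flat (Hom.toSchemeHom (((N : ℕ) : ℤ) • 𝟙 A)) := IsIsogeny.flat_toSchemeHom_holds hiso
  have hcard : Nat.card (A.torsionPoints L ((N : ℕ) : ℤ)) = (((N : ℕ)) : ℤ).natAbs ^ (2 * A.dim) :=
    natCard_torsionPoints_eq_of_isAlgClosed A L _ hNL'
  haveI : Finite (A.torsionPoints L ((N : ℕ) : ℤ)) :=
    Nat.finite_of_card_ne_zero (by
      rw [hcard, Int.natAbs_natCast]
      exact pow_ne_zero _ hN0)
  have hdeg : Module.finrank A.X.left.functionField (FunctionFieldOver (Hom.toSchemeHom (((N : ℕ) : ℤ) • 𝟙 A))) =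
      Nat.card (A.torsionPoints L ((N : ℕ) : ℤ)) := by
    rw [← hiso.kerRank_eq_finrank_functionFieldOver, kerRank_zsmul_id_holds A _ hNZ, hcard]
  -- Lang VII §2 Prop. 4: `Q ∈ K(Θ)`
  have hKT : (Q : A.Points L) ∈ A.KTheta Θ :=
    (A.mem_KTheta_iff Θ _).2 (weilDiv_linEquiv_zero_of_forall_weilPairingLevel_eq_one (Nat.pos_of_ne_zero hN0) hdeg Θ Q h)
  have hQK : (Q : A.Points L) ^ Nat.card (A.KTheta Θ) = 1 := A.pow_natCard_KTheta_eq_one hKT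
  have hQN : (Q : A.Points L) ^ N = 1 := by
    have hQ := (mem_torsionPoints_iff _ _).1 Q.2
    rwa [zpow_natCast] at hQ
  have h1 : (Q : A.Points L) ^ Nat.gcd N (Nat.card (A.KTheta Θ)) = 1 := pow_gcd_eq_one.mpr ⟨hQN, hQK⟩
  rw [hcop, pow_one] at h1
  exact Subtype.ext h1

/-- **LEFT NONDEGENERACY of `ē^Θ_N` when `gcd(N, #K(Θ)) = 1`**: if `ē^Θ_N(P, Q) = 1` for every `Q ∈ A[N](Ω)` then `P = 1` — by skew-symmetry
`ē(Q, P) = ē(P, Q)⁻¹` (★ `weilPairingLevel_swap`; `A(Ω)` is `N`-divisible, ★ `pow_surjective_of_isAlgClosed`) and the right case.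
[cite: Lang1983AbelianVarieties, Ch. VII §2 Prop. 4 and Thm. 5 (i)] -/
theorem weilPairingLevel_eq_one_of_forall_right_of_coprime {N : ℕ} (hNL : (N : L) ≠ 0)
    [IsDominant (Hom.toSchemeHom ((N : ℤ) • 𝟙 A))] (Θ : CartierDivisor A.X.left) (hcop : Nat.Coprime N (Nat.card (A.KTheta Θ)))
    (P : A.torsionPoints L N) (h : ∀ Q : A.torsionPoints L N, A.weilPairingLevel Θ P Q = 1) : P = 1 := by
  have hdiv := A.pow_surjective_of_isAlgClosed N hNL
  refine A.weilPairingLevel_eq_one_of_forall_left_of_coprime hNL Θ hcop P fun Q => ?_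
  rw [weilPairingLevel_swap (A := A) Θ P Q (hdiv P.1) (hdiv Q.1), h Q, inv_one]

/-- **PERFECTNESS in the `hl`∕`hr` costume of ★ `PerfectPairingUnits`**: for the `Ωˣ`-valued bimultiplicative `e(P, Q) := ē^Θ_N(P, Q)` (a unit by ★
`weilPairingLevel_ne_zero`), both radicals are trivial when `gcd(N, #K(Θ)) = 1`. [cite: MumfordAV1970, §20 (pp. 183–186)] -/
theorem weilPairingLevel_perfect_of_coprime {N : ℕ} (hNL : (N : L) ≠ 0) [IsDominant (Hom.toSchemeHom ((N : ℤ) • 𝟙 A))]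
    (Θ : CartierDivisor A.X.left) (hcop : Nat.Coprime N (Nat.card (A.KTheta Θ))) :
    (∀ P : A.torsionPoints L N, (∀ Q, Units.mk0 (A.weilPairingLevel Θ P Q) (weilPairingLevel_ne_zero Θ P Q) = 1) → P = 1) ∧
      (∀ Q : A.torsionPoints L N, (∀ P, Units.mk0 (A.weilPairingLevel Θ P Q) (weilPairingLevel_ne_zero Θ P Q) = 1) → Q = 1) := by
  have hiff : ∀ P Q : A.torsionPoints L N, Units.mk0 (A.weilPairingLevel Θ P Q) (weilPairingLevel_ne_zero Θ P Q) = 1 ↔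
      A.weilPairingLevel Θ P Q = 1 := fun P Q => by rw [← Units.val_eq_one, Units.val_mk0]
  exact ⟨fun P hP => A.weilPairingLevel_eq_one_of_forall_right_of_coprime hNL Θ hcop P fun Q => (hiff P Q).mp (hP Q),
    fun Q hQ => A.weilPairingLevel_eq_one_of_forall_left_of_coprime hNL Θ hcop Q fun P => (hiff P Q).mp (hQ P)⟩

/-! ### The count `#K · #K^⊥ = N^{2 dim A}` -/

/-- **`#K · #K^⊥ = N^{2 dim A}` for the level Weil pairing when `gcd(N, #K(Θ)) = 1`** (`Ω` algebraically closed, `(N : Ω) ≠ 0`): for every subgroup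
`K ≤ A[N](Ω)` and its right annihilator `K'` given by the membership clause `Q ∈ K' ↔ ∀ P ∈ K, ē^Θ_N(P, Q) = 1`, `Nat.card K * Nat.card K' = N ^ (2 * A.dim)`
(★ `PerfectPairingUnits.card_mul_card_eq_card_of_perfect_of_pow_eq_one` with `HasEnoughRootsOfUnity Ω N`, perfectness above, ★ `natCard_torsionPoints_eq_of_isAlgClosed`).
This is the `hcard` input of the quotient-dual engine at an algebraically closed point of ANY characteristic prime to `N`.
[cite: MumfordAV1970, §23 (p. 233)] [cite: Lang1983AbelianVarieties, Ch. VII §2 Prop. 4] -/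
theorem natCard_mul_natCard_annihilator_torsionPoints_of_coprime {N : ℕ} (hNL : (N : L) ≠ 0) [IsDominant (Hom.toSchemeHom ((N : ℤ) • 𝟙 A))]
    (Θ : CartierDivisor A.X.left) (hcop : Nat.Coprime N (Nat.card (A.KTheta Θ)))
    (K K' : Subgroup (A.torsionPoints L N)) (hK' : ∀ Q, Q ∈ K' ↔ ∀ P ∈ K, A.weilPairingLevel Θ P Q = 1) :
    Nat.card K * Nat.card K' = N ^ (2 * A.dim) := by
  have hN0 : N ≠ 0 := by rintro rfl; exact hNL Nat.cast_zero
  haveI : NeZero N := ⟨hN0⟩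
  haveI : NeZero (N : L) := ⟨hNL⟩
  have hcard : Nat.card (A.torsionPoints L (N : ℤ)) = N ^ (2 * A.dim) := by
    rw [natCard_torsionPoints_eq_of_isAlgClosed A L (N : ℤ) (by rw [Int.cast_natCast]; exact hNL), Int.natAbs_natCast]
  haveI : Finite (A.torsionPoints L (N : ℤ)) := Nat.finite_of_card_ne_zero (by rw [hcard]; exact pow_ne_zero _ hN0)
  obtain ⟨hl, hr⟩ := A.weilPairingLevel_perfect_of_coprime hNL Θ hcop
  -- the `Ωˣ`-valued bimultiplicative pairing
  let e : A.torsionPoints L N →* A.torsionPoints L N →* Lˣ :=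
    MonoidHom.mk' (fun P => MonoidHom.mk' (fun Q => Units.mk0 (A.weilPairingLevel Θ P Q) (weilPairingLevel_ne_zero Θ P Q))
      (fun Q Q' => Units.ext (by simp only [Units.val_mk0, Units.val_mul, weilPairingLevel_mul_right])))
      (fun P P' => by ext Q; simp only [MonoidHom.mk'_apply, MonoidHom.mul_apply, Units.val_mk0, Units.val_mul, weilPairingLevel_mul_left])
  have he : ∀ P Q, e P Q = Units.mk0 (A.weilPairingLevel Θ P Q) (weilPairingLevel_ne_zero Θ P Q) := fun P Q => rfl
  have hiff : ∀ P Q : A.torsionPoints L N, e P Q = 1 ↔ A.weilPairingLevel Θ P Q = 1 := fun P Q => by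
    rw [he, ← Units.val_eq_one, Units.val_mk0]
  have hpow : ∀ P : A.torsionPoints L N, P ^ N = 1 := fun P => Subtype.ext (by
    have hP := (mem_torsionPoints_iff _ _).1 P.2
    rw [zpow_natCast] at hP
    exact hP)
  have key := Literature.GroupTheory.Abelian.PerfectPairingUnits.card_mul_card_eq_card_of_perfect_of_pow_eq_one e hpow hpow
    (fun P hP => hl P fun Q => by rw [← he]; exact hP Q) (fun Q hQ => hr Q fun P => by rw [← he]; exact hQ P) K K'
    (fun Q => (hK' Q).trans ⟨fun hh P hP => (hiff P Q).mpr (hh P hP), fun hh P hP => (hiff P Q).mp (hh P hP)⟩)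
  rw [key, hcard]

/-- The same with the annihilator on the LEFT: `L' ≤ A[N](Ω)`, `P ∈ K ↔ ∀ Q ∈ L', ē^Θ_N(P, Q) = 1` ⇒ `Nat.card L' * Nat.card K = N ^ (2 * A.dim)`.
[cite: MumfordAV1970, §23 (p. 233)] -/
theorem natCard_mul_natCard_annihilator_torsionPoints_of_coprime_left {N : ℕ} (hNL : (N : L) ≠ 0) [IsDominant (Hom.toSchemeHom ((N : ℤ) • 𝟙 A))]
    (Θ : CartierDivisor A.X.left) (hcop : Nat.Coprime N (Nat.card (A.KTheta Θ)))
    (L' K : Subgroup (A.torsionPoints L N)) (hK : ∀ P, P ∈ K ↔ ∀ Q ∈ L', A.weilPairingLevel Θ P Q = 1) :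
    Nat.card L' * Nat.card K = N ^ (2 * A.dim) := by
  have hdiv := A.pow_surjective_of_isAlgClosed N hNL
  -- by skew-symmetry the left annihilator of `L'` is its right annihilator
  refine A.natCard_mul_natCard_annihilator_torsionPoints_of_coprime hNL Θ hcop L' K fun P => (hK P).trans ?_
  refine ⟨fun h Q hQ => ?_, fun h Q hQ => ?_⟩
  · rw [weilPairingLevel_swap (A := A) Θ P Q (hdiv P.1) (hdiv Q.1), h Q hQ, inv_one]
  · rw [weilPairingLevel_swap (A := A) Θ Q P (hdiv Q.1) (hdiv P.1), h Q hQ, inv_one]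

end AbelianVariety

end Literature.AlgebraicGeometry.Motives

end
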